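import Summits.QuantumFields.YangMills.Theses.CutoffNotchTransport
import Literature.MathematicalPhysics.QuantumFieldTheory.Balaban1983to89.T3FinestHeightTail

/-!
# Route `CutoffNotchTransport` — support item `BareCappedMomentL` (stmt-QuantumFields-26203), PROVED:
# the capped exponential moment of ONE bare plaquette is polynomially bounded in the bare inverse coupling

WHAT.  The base of the route's induction over ultraviolet notches: there are `t₁ > 0`, `C`, `N` such that for every three-torus family
`F`, every `0 < γ ≤ 1`, every cut-off `K`, every tilt `0 ≤ t ≤ t₁` and every plaquette `q` of the FINEST lattice of run `K`,
`∫ exp(t·β_K·min(|U(∂q) − 1|², θ(K)²)) dGibbs_K ≤ C·β_K^N`, `β_K = (γL^{-K})⁻¹` (here `t₁ = 1/8`, `N = 5`).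

THE ARGUMENT (a discrete layer cake; no change of variables).
§1 `exp_mul_min_le_sum` (pointwise, real numbers): for `t ≥ 0`, `β > 0`, `d ≥ 0` and any `θ`,
   `exp(tβ·min(d², θ²)) ≤ Σ_{k ≤ ⌊βθ²⌋} 𝟙[√(k/β) ≤ d]·e^{t(k+1)}` — with `X = min(d², θ²)` and `k₀ = ⌊βX⌋ ≤ ⌊βθ²⌋` one has
   `βX < k₀ + 1` and `k₀/β ≤ X ≤ d²`, so the `k₀`-th summand alone is `e^{t(k₀+1)} ≥ e^{tβX}`, the others are `≥ 0`.
§2 integrate against the (probability) Gibbs measure: `∫ e^{tβX} ≤ Σ_k e^{t(k+1)}·Gibbs_K{√(k/β) ≤ |U(∂q) − 1|}`, and the landed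
   single-plaquette chessboard tail `T3FinestHeightTail.gibbsMeasure_real_dist1_ge_le` (reflection positivity on Bałaban's tori, `d = 3`,
   `N = 2`, UNIFORM in the volume) bounds each probability by `2e^{24}c⁻³·(√β)^9·e^{−β(k/β)/4} = C₁(√β)^9 e^{−k/4}` (`β ≥ 1` from `γ ≤ 1`).
§3 for `t ≤ 1/8`: `e^{t(k+1)}e^{−k/4} ≤ e^{1/8}·(e^{−1/8})^k`, the geometric series sums to `(1 − e^{−1/8})⁻¹`, and `(√β)^9 ≤ β^5`:
   `∫ ≤ C₁·e^{1/8}(1 − e^{−1/8})⁻¹·β^5`.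

WHAT THIS IS NOT: not the route's crux `NotchMomentRatioL` (stmt-QuantumFields-26202, the one-notch transport, XL, open), not its glue;
no block-averaged plaquette is touched (that is where the renormalisation group enters).  Nothing here bears on the Yang–Mills mass gap:
the rung R3 (`YM3TorusSU2`) is a RECORD rung, not the Clay statement, and stays open.  (Width seat `ym-line-sfw-p2-w3` gen 20 of cell
ym-idea-1, taken per the director's staffing order 26203 → 26244 → 26245 of cell ym-r3-idea-2.)

References: J. Fröhlich, R. Israel, E. Lieb, B. Simon, CMP 62 (1978) 1–34 [FrohlichIsraelLiebSimon1978] (Thm 4.1, the chessboard estimate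
behind the single-plaquette tail); T. Bałaban, CMP 102 (1985) 255–275 [Balaban1985UV3] ((7) p.257 thresholds, (71) p.273 the large-field
factor `e^{−O(1)p(g)²}`).
-/

noncomputable section

namespace Summit.QuantumFields.YangMills.Theorems.CutoffNotchTransportBareCappedMoment

open MeasureTheory Finset
open Literature.MathematicalPhysics.QuantumFieldTheory
open Literature.MathematicalPhysics.QuantumFieldTheory.Balaban1983to89
open Literature.MathematicalPhysics.QuantumFieldTheory.Balaban1983to89.T3ContinuumYM3Torus
open Literature.MathematicalPhysics.QuantumFieldTheory.Balaban1983to89.T3UnitScaleTilt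
open Literature.MathematicalPhysics.QuantumFieldTheory.Balaban1983to89.T3UnitLawDensityEML
open Literature.MathematicalPhysics.QuantumFieldTheory.Balaban1983to89.T3FinestHeightTail (gibbsMeasure_real_dist1_ge_le)

/-! ## §1 The discrete layer cake (real numbers) -/

section Staircase

/-- **DISCRETE LAYER CAKE** for the capped square: for `t ≥ 0`, `β > 0`, `d ≥ 0`,
`exp(t·β·min(d², θ²)) ≤ Σ_{k < ⌊βθ²⌋+1} (if √(k/β) ≤ d then e^{t(k+1)} else 0)` — the summand with `k = ⌊β·min(d², θ²)⌋` alone dominates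
the left side, all summands are non-negative. [folklore] -/
theorem exp_mul_min_le_sum {t β d : ℝ} (θ : ℝ) (ht : 0 ≤ t) (hβ : 0 < β) (hd : 0 ≤ d) :
    Real.exp (t * β * min (d ^ 2) (θ ^ 2)) ≤
      ∑ k ∈ Finset.range (⌊β * θ ^ 2⌋₊ + 1), (if Real.sqrt (k / β) ≤ d then Real.exp (t * (k + 1)) else 0) := by
  set X : ℝ := min (d ^ 2) (θ ^ 2) with hXdef
  have hX0 : 0 ≤ X := le_min (sq_nonneg _) (sq_nonneg _)
  have hXθ : X ≤ θ ^ 2 := min_le_right _ _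
  have hXd : X ≤ d ^ 2 := min_le_left _ _
  have hβX0 : 0 ≤ β * X := mul_nonneg hβ.le hX0
  set k₀ : ℕ := ⌊β * X⌋₊ with hk₀def
  have hk₀le : (k₀ : ℝ) ≤ β * X := Nat.floor_le hβX0
  have hltk₀ : β * X < k₀ + 1 := Nat.lt_floor_add_one _
  have hmem : k₀ ∈ Finset.range (⌊β * θ ^ 2⌋₊ + 1) :=
    Finset.mem_range.mpr (Nat.lt_succ_of_le (Nat.floor_le_floor (mul_le_mul_of_nonneg_left hXθ hβ.le)))
  -- the `k₀`-th summand fires: `√(k₀/β) ≤ d`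
  have hfire : Real.sqrt (k₀ / β) ≤ d := by
    have h1 : (k₀ : ℝ) / β ≤ d ^ 2 := by
      rw [div_le_iff₀ hβ]
      calc (k₀ : ℝ) ≤ β * X := hk₀le
        _ ≤ β * d ^ 2 := mul_le_mul_of_nonneg_left hXd hβ.le
        _ = d ^ 2 * β := mul_comm _ _
    calc Real.sqrt (k₀ / β) ≤ Real.sqrt (d ^ 2) := Real.sqrt_le_sqrt h1
      _ = d := Real.sqrt_sq hd
  -- and dominates `exp(tβX)`
  have hdom : Real.exp (t * β * X) ≤ Real.exp (t * (k₀ + 1)) := by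
    refine Real.exp_le_exp.mpr ?_
    rw [mul_assoc]
    exact mul_le_mul_of_nonneg_left hltk₀.le ht
  calc Real.exp (t * β * X) ≤ Real.exp (t * (k₀ + 1)) := hdom
    _ = (if Real.sqrt (k₀ / β) ≤ d then Real.exp (t * (k₀ + 1)) else 0) := by rw [if_pos hfire]
    _ ≤ ∑ k ∈ Finset.range (⌊β * θ ^ 2⌋₊ + 1), (if Real.sqrt (k / β) ≤ d then Real.exp (t * (k + 1)) else 0) :=
        Finset.single_le_sum (f := fun k : ℕ => if Real.sqrt (k / β) ≤ d then Real.exp (t * ((k : ℝ) + 1)) else 0)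
          (fun k _ => by positivity) hmem

/-- The geometric bookkeeping for `t ≤ 1/8`: `Σ_{k < M} e^{t(k+1)}·e^{−k/4} ≤ e^{1/8}·(1 − e^{−1/8})⁻¹`. [folklore] -/
theorem sum_exp_mul_exp_neg_le {t : ℝ} (ht : t ≤ 1 / 8) (M : ℕ) :
    ∑ k ∈ Finset.range M, Real.exp (t * (k + 1)) * Real.exp (-(k / 4 : ℝ)) ≤
      Real.exp (1 / 8) * (1 - Real.exp (-(1 / 8 : ℝ)))⁻¹ := by
  have hr0 : 0 ≤ Real.exp (-(1 / 8 : ℝ)) := (Real.exp_pos _).le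
  have hr1 : Real.exp (-(1 / 8 : ℝ)) < 1 := Real.exp_lt_one_iff.mpr (by norm_num)
  have hterm : ∀ k : ℕ, Real.exp (t * (k + 1)) * Real.exp (-(k / 4 : ℝ)) ≤
      Real.exp (1 / 8) * Real.exp (-(1 / 8 : ℝ)) ^ k := by
    intro k
    rw [← Real.exp_nat_mul, ← Real.exp_add, ← Real.exp_add]
    refine Real.exp_le_exp.mpr ?_
    have hk : (0 : ℝ) ≤ k := Nat.cast_nonneg k
    nlinarith
  calc ∑ k ∈ Finset.range M, Real.exp (t * (k + 1)) * Real.exp (-(k / 4 : ℝ))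
      ≤ ∑ k ∈ Finset.range M, Real.exp (1 / 8) * Real.exp (-(1 / 8 : ℝ)) ^ k := Finset.sum_le_sum fun k _ => hterm k
    _ = Real.exp (1 / 8) * ∑ k ∈ Finset.range M, Real.exp (-(1 / 8 : ℝ)) ^ k := by rw [Finset.mul_sum]
    _ ≤ Real.exp (1 / 8) * ∑' k : ℕ, Real.exp (-(1 / 8 : ℝ)) ^ k := by
        refine mul_le_mul_of_nonneg_left ?_ (Real.exp_pos _).le
        exact (summable_geometric_of_lt_one hr0 hr1).sum_le_tsum _ fun k _ => pow_nonneg hr0 k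
    _ = Real.exp (1 / 8) * (1 - Real.exp (-(1 / 8 : ℝ)))⁻¹ := by rw [tsum_geometric_of_lt_one hr0 hr1]

end Staircase

/-! ## §2 The capped moment of one bare plaquette -/

section Moment

variable (F : T3Family)

/-- The bare inverse coupling `β_K = (γL^{-K})⁻¹` is `≥ 1` for `0 < γ ≤ 1` (`L ≥ 1`). [cite: Balaban1985UV3, (1)-(3) p.256] -/
theorem one_le_beta {γ : ℝ} (hγ : 0 < γ) (hγ1 : γ ≤ 1) (K : ℕ) : 1 ≤ (γ * ((F.L : ℝ)⁻¹) ^ K)⁻¹ := by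
  have hL1 : (1 : ℝ) ≤ F.L := by exact_mod_cast F.hL.2.le
  have hL0 : (0 : ℝ) < F.L := one_pos.trans_le hL1
  have hx0 : 0 < γ * ((F.L : ℝ)⁻¹) ^ K := mul_pos hγ (pow_pos (inv_pos.mpr hL0) K)
  have hx1 : γ * ((F.L : ℝ)⁻¹) ^ K ≤ 1 := by
    have hp : ((F.L : ℝ)⁻¹) ^ K ≤ 1 := pow_le_one₀ (inv_nonneg.mpr hL0.le) (inv_le_one_of_one_le₀ hL1)
    calc γ * ((F.L : ℝ)⁻¹) ^ K ≤ 1 * 1 := mul_le_mul hγ1 hp (pow_nonneg (inv_nonneg.mpr hL0.le) K) zero_le_one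
      _ = 1 := one_mul 1
  exact (one_le_inv₀ hx0).mpr hx1

/-- **THE CAPPED MOMENT OF ONE BARE PLAQUETTE, FROM A SINGLE-PLAQUETTE TAIL** (one family, one cut-off): if `β = (γL^{-K})⁻¹ > 0` and the
Gibbs probabilities of `{s ≤ |U(∂q) − 1|}` are at most `D·e^{−βs²/4}` for every `s ≥ 0`, then for `0 ≤ t ≤ 1/8` and any cap `θ`,
`∫ exp(t·β·min(|U(∂q) − 1|², θ²)) dGibbs_K ≤ D·e^{1/8}(1 − e^{−1/8})⁻¹` — the discrete layer cake of §1 integrated against the probability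
measure `Gibbs_K`, then the geometric sum. [cite: FrohlichIsraelLiebSimon1978, Thm 4.1] -/
theorem integral_exp_capped_le_of_tail {γ : ℝ} (hγ : 0 ≤ γ) (K : ℕ) (q : Plaq (F.P K) 0) (θ : ℝ) {t : ℝ} (ht0 : 0 ≤ t)
    (ht : t ≤ 1 / 8) (hβ : 0 < (γ * ((F.L : ℝ)⁻¹) ^ K)⁻¹) {D : ℝ} (hD : 0 ≤ D)
    (htail : ∀ s : ℝ, 0 ≤ s →
      (gibbsK F ℰp γ K).real {U | s ≤ GaugeGroup.dist1 (GaugeField.plaqHol U q)} ≤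
        D * Real.exp (-((γ * ((F.L : ℝ)⁻¹) ^ K)⁻¹ * s ^ 2 / 4))) :
    ∫ U, Real.exp (t * (γ * ((F.L : ℝ)⁻¹) ^ K)⁻¹ *
        min (GaugeGroup.dist1 (GaugeField.plaqHol U q) ^ 2) (θ ^ 2)) ∂(gibbsK F ℰp γ K) ≤
      D * (Real.exp (1 / 8) * (1 - Real.exp (-(1 / 8 : ℝ)))⁻¹) := by
  classical
  haveI := isProbabilityMeasure_gibbsK F ℰp hγ K
  set β : ℝ := (γ * ((F.L : ℝ)⁻¹) ^ K)⁻¹ with hβdef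
  set M : ℕ := ⌊β * θ ^ 2⌋₊ + 1 with hMdef
  -- the level sets and their measurability
  have hmeas_d : Measurable fun U : GaugeField (F.P K) 0 (Matrix.specialUnitaryGroup (Fin 2) ℂ) =>
      GaugeGroup.dist1 (GaugeField.plaqHol U q) :=
    RegularGaugeGroup.measurable_dist1.comp (Missing.measurable_plaqHol q)
  set S : ℕ → Set (GaugeField (F.P K) 0 (Matrix.specialUnitaryGroup (Fin 2) ℂ)) :=
    fun k => {U | Real.sqrt (k / β) ≤ GaugeGroup.dist1 (GaugeField.plaqHol U q)} with hSdef
  have hS : ∀ k, MeasurableSet (S k) := fun k => measurableSet_le measurable_const hmeas_d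
  -- pointwise staircase, in indicator form
  have hpt : ∀ U : GaugeField (F.P K) 0 (Matrix.specialUnitaryGroup (Fin 2) ℂ),
      Real.exp (t * β * min (GaugeGroup.dist1 (GaugeField.plaqHol U q) ^ 2) (θ ^ 2)) ≤
        ∑ k ∈ Finset.range M, (S k).indicator (fun _ => Real.exp (t * (k + 1))) U := by
    intro U
    refine (exp_mul_min_le_sum θ ht0 hβ (GaugeGroup.dist1_nonneg _)).trans (le_of_eq ?_)
    refine Finset.sum_congr rfl fun k _ => ?_
    rw [Set.indicator_apply]
    rfl
  -- integrability of both sides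
  have hint_lhs : Integrable (fun U : GaugeField (F.P K) 0 (Matrix.specialUnitaryGroup (Fin 2) ℂ) =>
      Real.exp (t * β * min (GaugeGroup.dist1 (GaugeField.plaqHol U q) ^ 2) (θ ^ 2))) (gibbsK F ℰp γ K) := by
    have hmeas : Measurable fun U : GaugeField (F.P K) 0 (Matrix.specialUnitaryGroup (Fin 2) ℂ) =>
        Real.exp (t * β * min (GaugeGroup.dist1 (GaugeField.plaqHol U q) ^ 2) (θ ^ 2)) :=
      Real.measurable_exp.comp (((hmeas_d.pow_const 2).min measurable_const).const_mul (t * β))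
    refine (integrable_const (Real.exp (t * β * θ ^ 2))).mono' hmeas.aestronglyMeasurable (ae_of_all _ fun U => ?_)
    rw [Real.norm_eq_abs, abs_of_pos (Real.exp_pos _)]
    exact Real.exp_le_exp.mpr (mul_le_mul_of_nonneg_left (min_le_right _ _) (mul_nonneg ht0 hβ.le))
  have hint_k : ∀ k ∈ Finset.range M, Integrable (fun U : GaugeField (F.P K) 0 (Matrix.specialUnitaryGroup (Fin 2) ℂ) =>
      (S k).indicator (fun _ => Real.exp (t * (k + 1))) U) (gibbsK F ℰp γ K) :=
    fun k _ => (integrable_const _).indicator (hS k)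
  have hint_rhs : Integrable (fun U : GaugeField (F.P K) 0 (Matrix.specialUnitaryGroup (Fin 2) ℂ) =>
      ∑ k ∈ Finset.range M, (S k).indicator (fun _ => Real.exp (t * (k + 1))) U) (gibbsK F ℰp γ K) :=
    integrable_finsetSum _ hint_k
  -- integrate, evaluate the indicators, insert the tail, sum the geometric series
  calc ∫ U, Real.exp (t * β * min (GaugeGroup.dist1 (GaugeField.plaqHol U q) ^ 2) (θ ^ 2)) ∂(gibbsK F ℰp γ K)
      ≤ ∫ U, ∑ k ∈ Finset.range M, (S k).indicator (fun _ => Real.exp (t * (k + 1))) U ∂(gibbsK F ℰp γ K) :=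
        integral_mono hint_lhs hint_rhs hpt
    _ = ∑ k ∈ Finset.range M, (gibbsK F ℰp γ K).real (S k) * Real.exp (t * (k + 1)) := by
        rw [integral_finsetSum _ hint_k]
        refine Finset.sum_congr rfl fun k _ => ?_
        rw [integral_indicator_const _ (hS k), smul_eq_mul]
    _ ≤ ∑ k ∈ Finset.range M, (D * Real.exp (-(k / 4 : ℝ))) * Real.exp (t * (k + 1)) := by
        refine Finset.sum_le_sum fun k _ => mul_le_mul_of_nonneg_right ?_ (Real.exp_pos _).le
        have hk0 : (0 : ℝ) ≤ k / β := div_nonneg (Nat.cast_nonneg k) hβ.le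
        have h1 := htail (Real.sqrt (k / β)) (Real.sqrt_nonneg _)
        have hexp : β * Real.sqrt (k / β) ^ 2 / 4 = (k / 4 : ℝ) := by
          rw [Real.sq_sqrt hk0]
          field_simp
        rw [hexp] at h1
        exact h1
    _ = D * ∑ k ∈ Finset.range M, Real.exp (t * (k + 1)) * Real.exp (-(k / 4 : ℝ)) := by
        rw [Finset.mul_sum]
        refine Finset.sum_congr rfl fun k _ => ?_
        ring
    _ ≤ D * (Real.exp (1 / 8) * (1 - Real.exp (-(1 / 8 : ℝ)))⁻¹) :=
        mul_le_mul_of_nonneg_left (sum_exp_mul_exp_neg_le ht M) hD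

end Moment

/-! ## §3 The item BY NAME -/

/-- **`BareCappedMomentL` (stmt-QuantumFields-26203), PROVED** — the base of route `CutoffNotchTransport`'s induction over ultraviolet
notches: with `t₁ = 1/8`, `N = 5` and `C = 2e^{24}c⁻³·e^{1/8}(1 − e^{−1/8})⁻¹` (`c = c(SU(2)) > 0` the Haar small-ball constant of the landed
chessboard tail), for every family `F`, every `0 < γ ≤ 1`, every `b₀ > 0`, `p₀`, every cut-off `K`, every `0 ≤ t ≤ t₁` and every bare plaquette
`q` of run `K`: `∫ exp(t·β_K·min(|U(∂q) − 1|², θ(K)²)) dGibbs_K ≤ C·β_K^5`.  Proof: `T3FinestHeightTail.gibbsMeasure_real_dist1_ge_le`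
(`d = 3`, `N = 2`: tail `2e^{24}c⁻³(√β)^9 e^{−βs²/4}`, volume-uniform), §2, and `(√β)^9 ≤ β^5` (`β_K ≥ 1`).  The crux of the route is not
touched; no rung or summit is proved. [cite: FrohlichIsraelLiebSimon1978, Thm 4.1] -/
theorem cutoffNotchTransport_bareCappedMomentL_proof :
    Summit.QuantumFields.YangMills.Theses.CutoffNotchTransport.BareCappedMomentL := by
  unfold Summit.QuantumFields.YangMills.Theses.CutoffNotchTransport.BareCappedMomentL
  obtain ⟨c, hc, -, htail⟩ := gibbsMeasure_real_dist1_ge_le (N := 2)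
  refine ⟨1 / 8, 2 * Real.exp 24 * (c ^ 3)⁻¹ * (Real.exp (1 / 8) * (1 - Real.exp (-(1 / 8 : ℝ)))⁻¹), 5,
    by norm_num, fun F γ b₀ p₀ hγ hγ1 _hb₀ K t ht0 ht q => ?_⟩
  set β : ℝ := (γ * ((F.L : ℝ)⁻¹) ^ K)⁻¹ with hβdef
  have hβ1 : 1 ≤ β := one_le_beta F hγ hγ1 K
  have hβ0 : 0 < β := one_pos.trans_le hβ1
  have hβeq : (F.scheme ℰp γ).β K = β := rfl
  -- the single-plaquette chessboard tail at every level `s ≥ 0`, `d = 3`, `N = 2`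
  have hC₁0 : 0 ≤ 2 * Real.exp 24 * (c ^ 3)⁻¹ * Real.sqrt β ^ 9 := by positivity
  have hD : ∀ s : ℝ, 0 ≤ s →
      (gibbsK F ℰp γ K).real {U | s ≤ GaugeGroup.dist1 (GaugeField.plaqHol U q)} ≤
        (2 * Real.exp 24 * (c ^ 3)⁻¹ * Real.sqrt β ^ 9) * Real.exp (-(β * s ^ 2 / 4)) := by
    intro s hs
    have h1 := htail (F.P K) β hβ1 s hs q
    have hcard2 : Fintype.card {r : Fin (F.P K).d × Fin (F.P K).d // r.1 < r.2} = 3 := by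
      rw [show (F.P K).d = 3 from rfl]; decide
    have hd3 : (F.P K).d = 3 := rfl
    rw [hcard2, hd3] at h1
    rw [gibbsK_eq, hβeq]
    refine h1.trans (le_of_eq ?_)
    have hexp : β * s ^ 2 / (2 * (2 : ℕ)) = β * s ^ 2 / 4 := by norm_num
    rw [hexp]
    norm_num
  -- §2 and `(√β)^9 ≤ β^5` (`β ≥ 1`; the tree's `LargeFieldMassRefinementTail.sqrt_pow_nine_le_pow_five`, inlined to keep this file
  -- free of the `SmallFieldWidening` cone)
  refine (integral_exp_capped_le_of_tail F hγ.le K q (θBal F.L γ b₀ p₀ K) ht0 ht hβ0 hC₁0 hD).trans ?_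
  have hs9 : Real.sqrt β ^ 9 ≤ β ^ 5 := by
    have hs : Real.sqrt β ^ 2 = β := Real.sq_sqrt hβ0.le
    have hsy : Real.sqrt β ≤ β := by
      rw [Real.sqrt_le_left hβ0.le]
      nlinarith
    calc Real.sqrt β ^ 9 = (Real.sqrt β ^ 2) ^ 4 * Real.sqrt β := by ring
      _ = β ^ 4 * Real.sqrt β := by rw [hs]
      _ ≤ β ^ 4 * β := by gcongr
      _ = β ^ 5 := by ring
  have hK0 : 0 ≤ 2 * Real.exp 24 * (c ^ 3)⁻¹ * (Real.exp (1 / 8) * (1 - Real.exp (-(1 / 8 : ℝ)))⁻¹) := by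
    have h18 : 0 < 1 - Real.exp (-(1 / 8 : ℝ)) := sub_pos.mpr (Real.exp_lt_one_iff.mpr (by norm_num))
    positivity
  calc 2 * Real.exp 24 * (c ^ 3)⁻¹ * Real.sqrt β ^ 9 * (Real.exp (1 / 8) * (1 - Real.exp (-(1 / 8 : ℝ)))⁻¹)
      = (2 * Real.exp 24 * (c ^ 3)⁻¹ * (Real.exp (1 / 8) * (1 - Real.exp (-(1 / 8 : ℝ)))⁻¹)) * Real.sqrt β ^ 9 := by ring
    _ ≤ (2 * Real.exp 24 * (c ^ 3)⁻¹ * (Real.exp (1 / 8) * (1 - Real.exp (-(1 / 8 : ℝ)))⁻¹)) * β ^ 5 :=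
        mul_le_mul_of_nonneg_left hs9 hK0

end Summit.QuantumFields.YangMills.Theorems.CutoffNotchTransportBareCappedMoment

end
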